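import Summits.KontsevichZagierPeriods.KontsevichZagierPeriods.Theorems.ValuedFieldSpecialisationCTConstructionBlowupRecast

/-!
# Route ValuedFieldSpecialisation — crux `CTConstruction`: splitting a block coordinate at `t = σ`

Helper toward crux stmt-KontsevichZagierPeriods-3495 (`CTConstruction`), line `registered`,
reshape r4 (blow-up elimination of the log block), stub `stub_blowup_split`. A **typed family**
over the elementary data `(p, q, B, d, r)` with types `a c : Fin B → ℕ` is a representation
`R : KZ.IntegralRep (B + d + 3)` with coordinates `z = (σ, s', v, t, w)` (`σ = z 0` the parameter,
`s' = z 1`, `v = z 2`, the block `t : Fin B → ℝ`, the fibre `w : Fin d → ℝ`), domain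
`0 < σ < 1`, `0 < s' < 1`, `0 < v`, `v ^ q σ ^ p < 1`, `σ ^ (a j) s' ^ (c j) ≤ t j ≤ 1`,
`w ∈ r.domain`, and integrand `s' ^ (1 - p/q) · ∏ (t j)⁻¹ · r.integrand w`. For a coordinate `t j`
of type `(1, 1)` (`a j = c j = 1`, lower bound `σ s'`) we split the domain at `t j = σ` (domain
additivity, the overlap `{t j = σ}` being a null hyperplane section): the piece `{σ ≤ t j}` is
VERBATIM the typed family of type `(1, 0)` at `j` (`c j` replaced by `0`; a restriction of `R`);
the piece `{t j ≤ σ}` is carried by the FIBRED substitution `t j = σ η` — the shear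
`Ψ z = update z i (z i * z 0)` of the index `i` of `t j`, a polynomial map fixing `z 0` with
Jacobian `z 0` (`exists_rep_of_sub_mem_fibredRelations_shear` of the companion file
`…CTConstructionSplitTyped.lean`) — onto the typed family of type `(0, 1)` at `j` (`a j` replaced
by `0`, `η ∈ [s', 1]`); the integrand is self-similar under the shear,
`f z = f (Ψ z) * z 0`, because `(σ η)⁻¹ σ = η⁻¹` and the weight `s' ^ (1 - p/q)` and the other
factors are untouched. This is a transcription of `stub_split_typedElementary` with one more
`vecCons` layer.

Sources: M. Kontsevich, D. Zagier, *Periods* (2001), §1.2 (rules (1)–(2)); J. Bochnak, M. Coste,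
M.-F. Roy, *Real Algebraic Geometry* (1998), §2.2 (Prop. 2.2.6, semialgebraic maps). No new
definitions.
-/

noncomputable section

namespace Summit.KontsevichZagierPeriods.ValuedFieldSpecialisation

open MeasureTheory Set Filter MvPolynomial
open scoped Topology
open Literature.NumberTheory.Transcendental Literature.NumberTheory.Transcendental.KZ
open Literature.ModelTheory.ExponentialFields (IsSemialgebraic isSemialgebraic_setOf_eval_le)

/-! ## Coordinates of the typed family with types `(a, c)` -/

/-- The `∃`-description of the domain of the typed blow-up family with types `a c : Fin B → ℕ`
(lower bounds `σ ^ (a j) * s' ^ (c j) ≤ t j`) agrees with its coordinate description (pattern of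
`typedDomain_eq` and `blowupTypedDomain_eq`). [folklore] -/
theorem blowupTypedDomainAC_eq {d : ℕ} (q p B : ℕ) (a c : Fin B → ℕ) (ρ : IntegralRep d) :
    {z : Fin (B + d + 1 + 1 + 1) → ℝ | ∃ (σ s' v : ℝ) (t : Fin B → ℝ) (w : Fin d → ℝ),
      z = Matrix.vecCons σ (Matrix.vecCons s' (Matrix.vecCons v (Fin.append t w))) ∧ 0 < σ ∧
        σ < 1 ∧ 0 < s' ∧ s' < 1 ∧ 0 < v ∧ v ^ q * σ ^ p < 1 ∧
        (∀ j', σ ^ (a j') * s' ^ (c j') ≤ t j' ∧ t j' ≤ 1) ∧ w ∈ ρ.domain} =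
    {z | 0 < z 0 ∧ z 0 < 1 ∧ 0 < z 1 ∧ z 1 < 1 ∧ 0 < z 2 ∧ z 2 ^ q * z 0 ^ p < 1 ∧
      (∀ j' : Fin B, z 0 ^ (a j') * z 1 ^ (c j') ≤ z (Fin.castAdd d j').succ.succ.succ ∧
        z (Fin.castAdd d j').succ.succ.succ ≤ 1) ∧
      (fun l : Fin d => z (Fin.natAdd B l).succ.succ.succ) ∈ ρ.domain} := by
  ext z
  simp only [mem_setOf_eq]
  constructor
  · rintro ⟨σ, s', v, t, w, rfl, hσ, hσ1, hs, hs1, hv, hvq, ht, hw⟩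
    refine ⟨by simpa using hσ, by simpa using hσ1, by simpa using hs, by simpa using hs1,
      by simpa using hv, by simpa using hvq, fun j' => by simpa using ht j', by simpa using hw⟩
  · rintro ⟨hσ, hσ1, hs, hs1, hv, hvq, ht, hw⟩
    exact ⟨z 0, z 1, z 2, _, _, (vecCons_vecCons_vecCons_append_eq z).symm, hσ, hσ1, hs, hs1,
      hv, hvq, ht, hw⟩

/-! ## Typed bands and the typed integrand under the shear -/

/-- Piece `{σ ≤ t j}` of the splitting: for `a j = c j = 1`, `σ > 0` and `s' ≤ 1`, the typed
band conditions with `c j` replaced by `0` (lower bound `σ` at `j`) are the typed band conditions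
(lower bound `σ s'` at `j`) together with `σ ≤ t j` (`σ s' ≤ σ`). [folklore] -/
theorem blowupBand_update_snd_iff {B : ℕ} {a c : Fin B → ℕ} {j : Fin B} (haj : a j = 1)
    (hcj : c j = 1) {σ s' : ℝ} (hσ : 0 < σ) (hs1 : s' < 1) (t : Fin B → ℝ) :
    (∀ j', σ ^ (a j') * s' ^ (Function.update c j 0 j') ≤ t j' ∧ t j' ≤ 1) ↔
      (∀ j', σ ^ (a j') * s' ^ (c j') ≤ t j' ∧ t j' ≤ 1) ∧ σ ≤ t j := by
  constructor
  · intro h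
    have hj := h j
    rw [Function.update_self, pow_zero, mul_one, haj, pow_one] at hj
    refine ⟨fun j' => ?_, hj.1⟩
    by_cases hne : j' = j
    · rw [hne, haj, hcj, pow_one, pow_one]
      exact ⟨(mul_le_of_le_one_right hσ.le hs1.le).trans hj.1, hj.2⟩
    · have := h j'
      rwa [Function.update_of_ne hne] at this
  · rintro ⟨h, hσj⟩ j'
    by_cases hne : j' = j
    · rw [hne, Function.update_self, pow_zero, mul_one, haj, pow_one]
      exact ⟨hσj, (h j).2⟩
    · rw [Function.update_of_ne hne]
      exact h j'

/-- Piece `{t j ≤ σ}` of the splitting read through the shear `t j = σ η`: for `a j = c j = 1`,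
`0 < σ < 1` and `t'` obtained from `t` by replacing `t j` with `t j * σ`, the typed band
conditions for `t` with `a j` replaced by `0` (`s' ≤ t j ≤ 1`) are the typed band conditions for
`t'` together with `t j * σ ≤ σ`. [folklore] -/
theorem blowupBand_update_fst_iff {B : ℕ} {a c : Fin B → ℕ} {j : Fin B} (haj : a j = 1)
    (hcj : c j = 1) {σ s' : ℝ} (hσ : 0 < σ) (hσ1 : σ < 1) {t t' : Fin B → ℝ}
    (htj : t' j = t j * σ) (ht' : ∀ j', j' ≠ j → t' j' = t j') :
    (∀ j', σ ^ (Function.update a j 0 j') * s' ^ (c j') ≤ t j' ∧ t j' ≤ 1) ↔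
      (∀ j', σ ^ (a j') * s' ^ (c j') ≤ t' j' ∧ t' j' ≤ 1) ∧ t j * σ ≤ σ := by
  constructor
  · intro h
    have hj := h j
    rw [Function.update_self, pow_zero, one_mul, hcj, pow_one] at hj
    have hts : t j * σ ≤ σ := mul_le_of_le_one_left hσ.le hj.2
    refine ⟨fun j' => ?_, hts⟩
    by_cases hne : j' = j
    · rw [hne, htj, haj, hcj, pow_one, pow_one]
      refine ⟨?_, hts.trans hσ1.le⟩
      rw [mul_comm (t j)]
      exact mul_le_mul_of_nonneg_left hj.1 hσ.le
    · rw [ht' j' hne]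
      have := h j'
      rwa [Function.update_of_ne hne] at this
  · rintro ⟨h, hle⟩ j'
    by_cases hne : j' = j
    · rw [hne, Function.update_self, pow_zero, one_mul, hcj, pow_one]
      have hj := h j
      rw [htj, haj, hcj, pow_one, pow_one] at hj
      have h1 : s' * σ ≤ t j * σ := by
        rw [mul_comm]
        exact hj.1
      exact ⟨le_of_mul_le_mul_right h1 hσ, le_of_mul_le_mul_right (by rwa [one_mul]) hσ⟩
    · rw [Function.update_of_ne hne, ← ht' j' hne]
      exact h j'

/-- The typed blow-up integrand `s' ^ e · ∏ (t j')⁻¹ · ρ(w)` transforms under the shear of the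
coordinate of `t j` by the Jacobian `z 0`: `f z = f (Ψ z) * z 0` for `z 0 ≠ 0`
(`(t_j σ)⁻¹ * σ = t_j⁻¹`; the weight `(z 1) ^ e` and the other coordinates read by `f` are
unchanged). [folklore] -/
theorem blowupTypedIntegrand_shear {B d : ℕ} (ρ : IntegralRep d) (e : ℝ) (j : Fin B)
    (z : Fin (B + d + 1 + 1 + 1) → ℝ) (h0 : z 0 ≠ 0) :
    z 1 ^ e * ((∏ j' : Fin B, (z (Fin.castAdd d j').succ.succ.succ)⁻¹) *
        ρ.integrand (fun l : Fin d => z (Fin.natAdd B l).succ.succ.succ)) =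
      Function.update z (Fin.castAdd d j).succ.succ.succ (z (Fin.castAdd d j).succ.succ.succ * z 0)
          1 ^ e *
        ((∏ j' : Fin B, (Function.update z (Fin.castAdd d j).succ.succ.succ
            (z (Fin.castAdd d j).succ.succ.succ * z 0) (Fin.castAdd d j').succ.succ.succ)⁻¹) *
          ρ.integrand (fun l : Fin d => Function.update z (Fin.castAdd d j).succ.succ.succ
            (z (Fin.castAdd d j).succ.succ.succ * z 0) (Fin.natAdd B l).succ.succ.succ)) * z 0 := by
  have hi1 : (1 : Fin (B + d + 1 + 1 + 1)) ≠ (Fin.castAdd d j).succ.succ.succ :=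
    (succ_succ_ne_one (Fin.castAdd d j).succ).symm
  have hw : ∀ l : Fin d, (Fin.natAdd B l).succ.succ.succ ≠ (Fin.castAdd d j).succ.succ.succ :=
    fun l h => by
    have h' := congrArg Fin.val h
    simp only [Fin.val_succ, Fin.val_natAdd, Fin.val_castAdd] at h'
    have := j.isLt
    omega
  have ht : ∀ j' : Fin B, j' ≠ j →
      (Fin.castAdd d j').succ.succ.succ ≠ (Fin.castAdd d j).succ.succ.succ := fun j' hne h =>
    hne (Fin.castAdd_injective _ _ (Fin.succ_inj.mp (Fin.succ_inj.mp (Fin.succ_inj.mp h))))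
  simp only [Function.update_of_ne (hw _), Function.update_of_ne hi1]
  have hprod : (∏ j' : Fin B, (Function.update z (Fin.castAdd d j).succ.succ.succ
      (z (Fin.castAdd d j).succ.succ.succ * z 0) (Fin.castAdd d j').succ.succ.succ)⁻¹) =
      (∏ j' : Fin B, (z (Fin.castAdd d j').succ.succ.succ)⁻¹) * (z 0)⁻¹ := by
    have hfac : ∀ j' : Fin B, (Function.update z (Fin.castAdd d j).succ.succ.succ
        (z (Fin.castAdd d j).succ.succ.succ * z 0) (Fin.castAdd d j').succ.succ.succ)⁻¹ =
        (z (Fin.castAdd d j').succ.succ.succ)⁻¹ * (if j' = j then (z 0)⁻¹ else 1) := by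
      intro j'
      by_cases hne : j' = j
      · rw [if_pos hne, hne, Function.update_self, mul_inv]
      · rw [if_neg hne, Function.update_of_ne (ht j' hne), mul_one]
    rw [Finset.prod_congr rfl fun j' _ => hfac j', Finset.prod_mul_distrib, Finset.prod_ite_eq']
    simp
  rw [hprod, mul_right_comm _ (z 0)⁻¹, mul_assoc (z 1 ^ e) _ (z 0), inv_mul_cancel_right₀ h0]

/-! ## The stub -/

/-- **Stub `stub_blowup_split`.** For a typed blow-up family `R` (types `a`, `c`) and a block
coordinate `t j` of type `(1, 1)` (`a j = c j = 1`, lower bound `σ s'`), splitting at `t j = σ`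
gives, modulo FIBRED relations, `[R] ≡ [R₁] + [R₂]`: `R.domain = A ∪ B'` with
`A = R.domain ∩ {σ ≤ t j}` — the typed domain with `c j` replaced by `0`, `R₁ = R|A` — and
`B' = R.domain ∩ {t j ≤ σ}`, overlapping in a null hyperplane section, so
`[R] - [R|A] - [R|B'] ∈ fibredRelations` (domain additivity); and `R|B'` is carried by the shear
`t j = σ η` (a fibred change of variables, `exists_rep_of_sub_mem_fibredRelations_shear`,
`(σ η)⁻¹ σ = η⁻¹`) onto the typed family `R₂` with `a j` replaced by `0`, whose domain is the
preimage of `B'`. [Kontsevich–Zagier 2001, §1.2 rules (1)–(2)] [folklore] -/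
theorem stub_blowup_split : ∀ (p q B d : ℕ) (r : Literature.NumberTheory.Transcendental.KZ.IntegralRep d) (a c : Fin B → ℕ) (j : Fin B) (R : Literature.NumberTheory.Transcendental.KZ.IntegralRep (B + d + 1 + 1 + 1)), a j = 1 → c j = 1 → R.domain = {z | ∃ (σ s' v : ℝ) (t : Fin B → ℝ) (w : Fin d → ℝ), z = Matrix.vecCons σ (Matrix.vecCons s' (Matrix.vecCons v (Fin.append t w))) ∧ 0 < σ ∧ σ < 1 ∧ 0 < s' ∧ s' < 1 ∧ 0 < v ∧ v ^ q * σ ^ p < 1 ∧ (∀ j', σ ^ (a j') * s' ^ (c j') ≤ t j' ∧ t j' ≤ 1) ∧ w ∈ r.domain} → R.integrand = (fun z => z 1 ^ ((1 - (p : ℚ) / q : ℚ) : ℝ) * ((∏ j : Fin B, (z (Fin.castAdd d j).succ.succ.succ)⁻¹) * r.integrand (fun l : Fin d => z (Fin.natAdd B l).succ.succ.succ))) → ∃ R₁ R₂ : Literature.NumberTheory.Transcendental.KZ.IntegralRep (B + d + 1 + 1 + 1), R₁.domain = {z | ∃ (σ s' v : ℝ) (t : Fin B → ℝ) (w : Fin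 d → ℝ), z = Matrix.vecCons σ (Matrix.vecCons s' (Matrix.vecCons v (Fin.append t w))) ∧ 0 < σ ∧ σ < 1 ∧ 0 < s' ∧ s' < 1 ∧ 0 < v ∧ v ^ q * σ ^ p < 1 ∧ (∀ j', σ ^ (a j') * s' ^ (Function.update c j 0 j') ≤ t j' ∧ t j' ≤ 1) ∧ w ∈ r.domain} ∧ R₁.integrand = (fun z => z 1 ^ ((1 - (p : ℚ) / q : ℚ) : ℝ) * ((∏ j : Fin B, (z (Fin.castAdd d j).succ.succ.succ)⁻¹) * r.integrand (fun l : Fin d => z (Fin.natAdd B l).succ.succ.succ))) ∧ R₂.domain = {z | ∃ (σ s' v : ℝ) (t : Fin B → ℝ) (w : Fin d → ℝ), z = Matrix.vecCons σ (Matrix.vecCons s' (Matrix.vecCons v (Fin.append t w))) ∧ 0 < σ ∧ σ < 1 ∧ 0 < s' ∧ s' < 1 ∧ 0 < v ∧ v ^ q * σ ^ p < 1 ∧ (∀ j', σ ^ (Function.update a j 0 j') * s' ^ (c j') ≤ t j' ∧ t j' ≤ 1) ∧ w ∈ r.domain} ∧ R₂.integrand = (fun z => z 1 ^ ((1 - (p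 : ℚ) / q : ℚ) : ℝ) * ((∏ j : Fin B, (z (Fin.castAdd d j).succ.succ.succ)⁻¹) * r.integrand (fun l : Fin d => z (Fin.natAdd B l).succ.succ.succ))) ∧ Literature.NumberTheory.Transcendental.KZ.of R - Literature.NumberTheory.Transcendental.KZ.of R₁ - Literature.NumberTheory.Transcendental.KZ.of R₂ ∈ Literature.NumberTheory.Transcendental.KZ.fibredRelations := by
  intro p q B d r a c j R haj hcj hR hRi
  rw [blowupTypedDomainAC_eq q p B a (Function.update c j 0) r,
    blowupTypedDomainAC_eq q p B (Function.update a j 0) c r]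
  replace hR := hR.trans (blowupTypedDomainAC_eq q p B a c r)
  -- the index `i` of `t j`; it differs from `0`, `1`, `2`, the other `t j'` and the `w l`
  have h3 : 2 < B + d + 1 + 1 + 1 := by omega
  have hk2 : ∀ k : Fin (B + d), k.succ.succ.succ ≠ (2 : Fin (B + d + 1 + 1 + 1)) := fun k => by
    simp [Fin.ext_iff, Nat.mod_eq_of_lt h3]
  set i : Fin (B + d + 1 + 1 + 1) := (Fin.castAdd d j).succ.succ.succ with hi
  have hi0 : i ≠ 0 := Fin.succ_ne_zero _
  have hi1 : i ≠ 1 := succ_succ_ne_one (Fin.castAdd d j).succ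
  have hi2 : i ≠ 2 := hk2 (Fin.castAdd d j)
  have hit : ∀ j' : Fin B, j' ≠ j → (Fin.castAdd d j').succ.succ.succ ≠ i := fun j' hne h =>
    hne (Fin.castAdd_injective _ _ (Fin.succ_inj.mp (Fin.succ_inj.mp (Fin.succ_inj.mp h))))
  have hiw : ∀ l : Fin d, (Fin.natAdd B l).succ.succ.succ ≠ i := fun l h => by
    have h' := congrArg Fin.val h
    simp only [hi, Fin.val_succ, Fin.val_natAdd, Fin.val_castAdd] at h'
    have := j.isLt
    omega
  -- the pieces `A = R.domain ∩ {σ ≤ t j}`, `B' = R.domain ∩ {t j ≤ σ}`; the overlap is null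
  have hle_sa : IsSemialgebraic ℚ {z : Fin (B + d + 1 + 1 + 1) → ℝ | z 0 ≤ z i} := by
    simpa using isSemialgebraic_setOf_eval_le (k := ℚ) (R := ℝ)
      (X (0 : Fin (B + d + 1 + 1 + 1)) : MvPolynomial (Fin (B + d + 1 + 1 + 1)) ℚ) (X i)
  have hge_sa : IsSemialgebraic ℚ {z : Fin (B + d + 1 + 1 + 1) → ℝ | z i ≤ z 0} := by
    simpa using isSemialgebraic_setOf_eval_le (k := ℚ) (R := ℝ)
      (X i : MvPolynomial (Fin (B + d + 1 + 1 + 1)) ℚ) (X 0)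
  set A : Set (Fin (B + d + 1 + 1 + 1) → ℝ) := R.domain ∩ {z | z 0 ≤ z i} with hA
  set B' : Set (Fin (B + d + 1 + 1 + 1) → ℝ) := R.domain ∩ {z | z i ≤ z 0} with hB'
  have hAsa : IsSemialgebraic ℚ A := R.isSemialgebraic_domain.inter hle_sa
  have hB'sa : IsSemialgebraic ℚ B' := R.isSemialgebraic_domain.inter hge_sa
  have hunion : R.domain = A ∪ B' := by
    rw [hA, hB', ← inter_union_distrib_left]
    exact (inter_eq_left.mpr fun z _ => le_total (z 0) (z i)).symm
  have hnull : volume (A ∩ B') = 0 :=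
    measure_mono_null (fun z hz => le_antisymm hz.2.2 hz.1.2)
      (Literature.Analysis.SpecialFunctions.Selberg.volume_setOf_apply_eq hi0)
  have hsplit := of_sub_of_restrict_sub_of_restrict_mem_fibredRelations R hAsa hB'sa hunion hnull
  have hAsub : A ⊆ R.domain := hunion ▸ subset_union_left
  have hB'sub : B' ⊆ R.domain := hunion ▸ subset_union_right
  -- transport `R|B'` through the shear `Ψ z = update z i (z i * z 0)`
  have hΨ0 : ∀ z : Fin (B + d + 1 + 1 + 1) → ℝ, Function.update z i (z i * z 0) 0 = z 0 :=
    fun z => Function.update_of_ne hi0.symm _ _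
  have hB'pos : ∀ z ∈ (R.restrict B' hB'sa hB'sub).domain, 0 < z 0 := fun z hz => by
    have hz' : z ∈ R.domain := hz.1
    rw [hR] at hz'
    exact hz'.1
  obtain ⟨R₂, hR₂d, hR₂i, hrel⟩ := exists_rep_of_sub_mem_fibredRelations_shear i hi0
    (R.restrict B' hB'sa hB'sub)
    (f := fun z => z 1 ^ ((1 - (p : ℚ) / q : ℚ) : ℝ) *
      ((∏ j : Fin B, (z (Fin.castAdd d j).succ.succ.succ)⁻¹) *
        r.integrand (fun l : Fin d => z (Fin.natAdd B l).succ.succ.succ)))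
    (fun z => by rw [IntegralRep.integrand_restrict, hRi]) hB'pos
    (fun z hz => blowupTypedIntegrand_shear r _ j z (hΨ0 z ▸ hB'pos _ hz).ne')
  refine ⟨R.restrict A hAsa hAsub, R₂, ?_, hRi, ?_, hR₂i, ?_⟩
  · -- `A` is the typed domain with `c j` replaced by `0`
    ext z
    simp only [IntegralRep.domain_restrict, hA, hR, mem_inter_iff, mem_setOf_eq]
    constructor
    · rintro ⟨⟨h0, h1, hs, hs1, hv, hvq, ht, hw⟩, hle⟩
      exact ⟨h0, h1, hs, hs1, hv, hvq, (blowupBand_update_snd_iff haj hcj h0 hs1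
        (fun j' => z (Fin.castAdd d j').succ.succ.succ)).mpr ⟨ht, hle⟩, hw⟩
    · rintro ⟨h0, h1, hs, hs1, hv, hvq, ht, hw⟩
      obtain ⟨ht', hle⟩ := (blowupBand_update_snd_iff haj hcj h0 hs1
        (fun j' => z (Fin.castAdd d j').succ.succ.succ)).mp ht
      exact ⟨⟨h0, h1, hs, hs1, hv, hvq, ht', hw⟩, hle⟩
  · -- `R₂.domain = Ψ ⁻¹' B'` is the typed domain with `a j` replaced by `0`
    rw [hR₂d]
    ext z
    have htj : Function.update z i (z i * z 0) (Fin.castAdd d j).succ.succ.succ =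
        z (Fin.castAdd d j).succ.succ.succ * z 0 := by
      rw [hi, Function.update_self]
    have ht' : ∀ j' : Fin B, j' ≠ j →
        Function.update z i (z i * z 0) (Fin.castAdd d j').succ.succ.succ =
          z (Fin.castAdd d j').succ.succ.succ :=
      fun j' hne => Function.update_of_ne (hit j' hne) _ _
    have hΨw : (fun l : Fin d => Function.update z i (z i * z 0) (Fin.natAdd B l).succ.succ.succ) =
        fun l => z (Fin.natAdd B l).succ.succ.succ :=
      funext fun l => Function.update_of_ne (hiw l) _ _
    simp only [IntegralRep.domain_restrict, hB', hR, mem_inter_iff, mem_setOf_eq, hΨ0, hΨw,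
      Function.update_self, Function.update_of_ne (Ne.symm hi1),
      Function.update_of_ne (Ne.symm hi2)]
    constructor
    · rintro ⟨⟨h0, h1, hs, hs1, hv, hvq, ht'', hw⟩, hle⟩
      exact ⟨h0, h1, hs, hs1, hv, hvq, (blowupBand_update_fst_iff haj hcj h0 h1
        (t := fun j' => z (Fin.castAdd d j').succ.succ.succ)
        (t' := fun j' => Function.update z i (z i * z 0) (Fin.castAdd d j').succ.succ.succ)
        htj ht').mpr ⟨ht'', hle⟩, hw⟩
    · rintro ⟨h0, h1, hs, hs1, hv, hvq, ht, hw⟩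
      obtain ⟨ht'', hle⟩ := (blowupBand_update_fst_iff haj hcj h0 h1
        (t := fun j' => z (Fin.castAdd d j').succ.succ.succ)
        (t' := fun j' => Function.update z i (z i * z 0) (Fin.castAdd d j').succ.succ.succ)
        htj ht').mp ht
      exact ⟨⟨h0, h1, hs, hs1, hv, hvq, ht'', hw⟩, hle⟩
  · have hsum : of R - of (R.restrict A hAsa hAsub) - of R₂ =
        (of R - of (R.restrict A hAsa hAsub) - of (R.restrict B' hB'sa hB'sub)) +
          (of (R.restrict B' hB'sa hB'sub) - of R₂) := by
      abel
    rw [hsum]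
    exact fibredRelations.add_mem hsplit hrel

end Summit.KontsevichZagierPeriods.ValuedFieldSpecialisation
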